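import Mathlib
import HarnessLib
import Summits.HubbardSuperconductivity.HubbardSuperconductivity.Theorems.KLProgrammeKLRegimeEngineLastStepResponseFit

/-!
# K3 gen-8-FLOW (stmt 20437, stub (C), located item #20, cure (δ′) «LAST-STEP SWAP», layer F3a′): THE FIT WITH SEPARATE CONSTANTS —
# `ω₀ ≤ Zω/l`, `η₀ + η ≤ 2·Zt·U/l`, `PP_a ≤ Za·lʲ`, `PP_b ≤ Zb·U·lʲ`, `PP_c ≤ Zc·U²·lʲ/l`, `AA_X ≤ ZA_X·U³·lᵏ/l²` ⟹ rows `≤ C·U³·lᵏ/l²`,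
# `C = 2²⁹·Zω·Zt³·Za + 2³⁸·Zt²·Zb + 2³³·Zt·Zc + (ZA_a + ZA_b + ZA_c)`, and the fit under `16·C·U ≤ 1`

Cell gate-hubbard-kl, seat p2 g17.  `…EngineLastStepResponseFit` (F3a) books every table against ONE constant `Z` and asks `2⁴³·Z⁵·U ≤ 1`; the fifth
power is an artefact of the single currency (the frequency window `Zω = 1/32`, the tangential-parameter constant `Zt`, the moment tables and the alias
rows are unrelated numbers, and the curve numerics `klCurveD•` enter `Zt` only).  This module is the same arithmetic with the constants kept apart, so
that the closer's threshold check against the NAMED `klLastRespU P R` (`…EngineLastRespDefs`) reads `16·C ≤ 2²⁵⁶·klEngPsq⁴·klEngRsq⁸·(klE3Acum²+1)²`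
with the true `C`.

* `lastResponse_rows_le_multi` — the three rows `≤ C·U³·lᵏ/l²`;
* `lastResponse_rows_fit_curveJetBar_multi` — `C·U³·lᵏ/l² ≤ curveJetBar e_R e_R′ U k (m+1)` (`e_R = (0,1,1,1,1)`, `e_R′ = (1,0,0,0,0)`) once `16·C·U ≤ 1`;
* `lastResponse_rows_fit_multi_of_le_klLastRespU` — the same from `U ≤ klLastRespU P R` when `16·C ≤` its denominator.

Arithmetic only; no definitions; nothing asserts superconductivity.  Refs: BGM 2006 §2.4 (2.36)–(2.42) [cite: BenfattoGiulianiMastropietro2006].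
-/

noncomputable section

namespace Summit.HubbardSuperconductivity.HubbardSuperconductivity.Theorems.EngineV8

set_option linter.dupNamespace false -- summit = problem name (single-conjunct summit), D-0017

open Real Finset
open Summit.HubbardSuperconductivity.HubbardSuperconductivity.Theorems.KLRegimeSplit

/-- **THE DOOR'S ROWS WITH SEPARATE CONSTANTS.**  `1 ≤ l`; `η₀, η ≥ 0`, `η₀ + η ≤ 2·Zt·U/l`; `0 ≤ ω₀ ≤ Zω/l`;
`0 ≤ PP_a j ≤ Za·lʲ`, `0 ≤ PP_b j ≤ Zb·U·lʲ`, `0 ≤ PP_c j ≤ Zc·U²·lʲ/l` (`j ≤ 4`); `AA_X k ≤ ZA_X·U³·lᵏ/l²` (`k ≤ 4`).  Then for `k ≤ 4` the three rows of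
`lastResponse_jets_door` sum to `≤ (2²⁹·Zω·Zt³·Za + 2³⁸·Zt²·Zb + 2³³·Zt·Zc + (ZA_a + ZA_b + ZA_c))·U³·lᵏ/l²`. -/
theorem lastResponse_rows_le_multi {U l ω₀ η₀ η Zω Zt Za Zb Zc ZAa ZAb ZAc : ℝ} (hl : 1 ≤ l)
    (h0 : 0 ≤ η₀) (hη : 0 ≤ η) (hA : η₀ + η ≤ 2 * Zt * U / l) (hω0 : 0 ≤ ω₀) (hω : ω₀ ≤ Zω / l)
    {PPa PPb PPc AAa AAb AAc : ℕ → ℝ}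
    (hPPa0 : ∀ j ≤ 4, 0 ≤ PPa j) (hPPa : ∀ j ≤ 4, PPa j ≤ Za * l ^ j)
    (hPPb0 : ∀ j ≤ 4, 0 ≤ PPb j) (hPPb : ∀ j ≤ 4, PPb j ≤ Zb * U * l ^ j)
    (hPPc0 : ∀ j ≤ 4, 0 ≤ PPc j) (hPPc : ∀ j ≤ 4, PPc j ≤ Zc * U ^ 2 * l ^ j / l)
    (hAAa : ∀ k ≤ 4, AAa k ≤ ZAa * U ^ 3 * l ^ k / l ^ 2) (hAAb : ∀ k ≤ 4, AAb k ≤ ZAb * U ^ 3 * l ^ k / l ^ 2)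
    (hAAc : ∀ k ≤ 4, AAc k ≤ ZAc * U ^ 3 * l ^ k / l ^ 2) :
    ∀ k ≤ 4,
      ((∑ i ∈ range (k + 1), (k.choose i : ℝ) * (ω₀ * (2 ^ 22 * (η₀ + η) ^ 3 * l ^ i)) * PPa (k - i)) + AAa k) +
      ((∑ i ∈ range (k + 1), (k.choose i : ℝ) * (2 ^ 32 * (η₀ + η) ^ 2 * l ^ i) * PPb (k - i)) + AAb k) +
      ((∑ i ∈ range (k + 1), (k.choose i : ℝ) * (2 ^ 28 * (η₀ + η) * l ^ i) * PPc (k - i)) + AAc k) ≤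
        (2 ^ 29 * Zω * Zt ^ 3 * Za + 2 ^ 38 * Zt ^ 2 * Zb + 2 ^ 33 * Zt * Zc + (ZAa + ZAb + ZAc)) * U ^ 3 * l ^ k / l ^ 2 := by
  intro k hk
  have hl0 : 0 ≤ l := by linarith
  have hlpos : 0 < l := by linarith
  have hA0 : 0 ≤ η₀ + η := by linarith
  have hZa : 0 ≤ Za := by have := (hPPa0 0 (by norm_num)).trans (hPPa 0 (by norm_num)); simpa using this
  have hZbU : 0 ≤ Zb * U := by have := (hPPb0 0 (by norm_num)).trans (hPPb 0 (by norm_num)); simpa using this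
  have hZcU : 0 ≤ Zc * U ^ 2 / l := by
    have := (hPPc0 0 (by norm_num)).trans (hPPc 0 (by norm_num)); simpa using this
  have hZω : 0 ≤ Zω := by
    have h2 : 0 ≤ Zω / l := hω0.trans hω
    by_contra hneg
    have : Zω / l < 0 := div_neg_of_neg_of_pos (lt_of_not_ge hneg) hlpos
    linarith
  -- the three Leibniz sums
  have hSa := sum_choose_mul_le (φ := fun i => ω₀ * (2 ^ 22 * (η₀ + η) ^ 3 * l ^ i)) (PP := PPa) (Φ := ω₀ * 2 ^ 22 * (η₀ + η) ^ 3) (P := Za) k hl0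
    (by positivity) (fun i _ => le_of_eq (by ring)) (fun j hj => hPPa0 j (hj.trans hk)) (fun j hj => hPPa j (hj.trans hk))
  have hSb := sum_choose_mul_le (φ := fun i => 2 ^ 32 * (η₀ + η) ^ 2 * l ^ i) (PP := PPb) (Φ := 2 ^ 32 * (η₀ + η) ^ 2) (P := Zb * U) k hl0
    (by positivity) (fun i _ => le_of_eq (by ring)) (fun j hj => hPPb0 j (hj.trans hk)) (fun j hj => hPPb j (hj.trans hk))
  have hSc := sum_choose_mul_le (φ := fun i => 2 ^ 28 * (η₀ + η) * l ^ i) (PP := PPc) (Φ := 2 ^ 28 * (η₀ + η)) (P := Zc * U ^ 2 / l) k hl0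
    (by positivity) (fun i _ => le_of_eq (by ring)) (fun j hj => hPPc0 j (hj.trans hk))
    (fun j hj => (hPPc j (hj.trans hk)).trans_eq (by ring))
  have h2k : (2 : ℝ) ^ k ≤ 16 := by
    have : (2 : ℝ) ^ k ≤ 2 ^ 4 := pow_le_pow_right₀ (by norm_num) hk
    linarith [show (2 : ℝ) ^ 4 = 16 by norm_num]
  have hAl : (η₀ + η) * l ≤ 2 * Zt * U := by rwa [← le_div_iff₀ hlpos]
  have hωl : ω₀ * l ≤ Zω := by rwa [← le_div_iff₀ hlpos]
  -- row a
  have hRa : 2 ^ k * (ω₀ * 2 ^ 22 * (η₀ + η) ^ 3) * Za * l ^ k ≤ 2 ^ 29 * Zω * Zt ^ 3 * Za * U ^ 3 * l ^ k / l ^ 2 := by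
    rw [le_div_iff₀ (by positivity)]
    have h3 : ((η₀ + η) * l) ^ 3 ≤ (2 * Zt * U) ^ 3 := by gcongr
    have h4 : ω₀ * (η₀ + η) ^ 3 * l ^ 4 ≤ Zω * (8 * Zt ^ 3 * U ^ 3) := by
      have : ω₀ * (η₀ + η) ^ 3 * l ^ 4 = (ω₀ * l) * ((η₀ + η) * l) ^ 3 := by ring
      rw [this]
      calc (ω₀ * l) * ((η₀ + η) * l) ^ 3 ≤ Zω * (2 * Zt * U) ^ 3 := mul_le_mul hωl h3 (by positivity) hZω
        _ = Zω * (8 * Zt ^ 3 * U ^ 3) := by ring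
    have h5 : ω₀ * (η₀ + η) ^ 3 * l ^ 2 ≤ Zω * (8 * Zt ^ 3 * U ^ 3) := by
      have : ω₀ * (η₀ + η) ^ 3 * l ^ 2 ≤ ω₀ * (η₀ + η) ^ 3 * l ^ 4 := by
        have : l ^ 2 ≤ l ^ 4 := pow_le_pow_right₀ hl (by norm_num)
        have : 0 ≤ ω₀ * (η₀ + η) ^ 3 := by positivity
        nlinarith
      linarith
    calc 2 ^ k * (ω₀ * 2 ^ 22 * (η₀ + η) ^ 3) * Za * l ^ k * l ^ 2 = (2 ^ k) * (2 ^ 22 * Za * l ^ k) * (ω₀ * (η₀ + η) ^ 3 * l ^ 2) := by ring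
      _ ≤ 16 * (2 ^ 22 * Za * l ^ k) * (Zω * (8 * Zt ^ 3 * U ^ 3)) := by
          apply mul_le_mul (mul_le_mul_of_nonneg_right h2k (by positivity)) h5 (by positivity) (by positivity)
      _ = 2 ^ 29 * Zω * Zt ^ 3 * Za * U ^ 3 * l ^ k := by ring
  -- row b
  have hRb : 2 ^ k * (2 ^ 32 * (η₀ + η) ^ 2) * (Zb * U) * l ^ k ≤ 2 ^ 38 * Zt ^ 2 * Zb * U ^ 3 * l ^ k / l ^ 2 := by
    rw [le_div_iff₀ (by positivity)]
    have h3 : ((η₀ + η) * l) ^ 2 ≤ (2 * Zt * U) ^ 2 := by gcongr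
    calc 2 ^ k * (2 ^ 32 * (η₀ + η) ^ 2) * (Zb * U) * l ^ k * l ^ 2 = (2 ^ k) * (2 ^ 32 * (Zb * U) * l ^ k) * ((η₀ + η) * l) ^ 2 := by ring
      _ ≤ 16 * (2 ^ 32 * (Zb * U) * l ^ k) * (2 * Zt * U) ^ 2 := by
          apply mul_le_mul (mul_le_mul_of_nonneg_right h2k (by positivity)) h3 (by positivity) (by positivity)
      _ = 2 ^ 38 * Zt ^ 2 * Zb * U ^ 3 * l ^ k := by ring
  -- row c
  have hRc : 2 ^ k * (2 ^ 28 * (η₀ + η)) * (Zc * U ^ 2 / l) * l ^ k ≤ 2 ^ 33 * Zt * Zc * U ^ 3 * l ^ k / l ^ 2 := by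
    rw [le_div_iff₀ (by positivity)]
    have : 2 ^ k * (2 ^ 28 * (η₀ + η)) * (Zc * U ^ 2 / l) * l ^ k * l ^ 2 = (2 ^ k) * (2 ^ 28 * (Zc * U ^ 2 / l) * l * l ^ k) * ((η₀ + η) * l) := by
      ring
    rw [this]
    have hZcl : 0 ≤ 2 ^ 28 * (Zc * U ^ 2 / l) * l * l ^ k := by positivity
    calc (2 ^ k) * (2 ^ 28 * (Zc * U ^ 2 / l) * l * l ^ k) * ((η₀ + η) * l) ≤ 16 * (2 ^ 28 * (Zc * U ^ 2 / l) * l * l ^ k) * (2 * Zt * U) := by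
          apply mul_le_mul (mul_le_mul_of_nonneg_right h2k hZcl) hAl (mul_nonneg hA0 hl0) (by positivity)
      _ = 2 ^ 33 * Zt * Zc * U ^ 3 * l ^ k := by field_simp; norm_num
  have t1 := add_le_add (add_le_add (add_le_add (hSa.trans hRa) (hAAa k hk)) (add_le_add (hSb.trans hRb) (hAAb k hk)))
    (add_le_add (hSc.trans hRc) (hAAc k hk))
  have e1 : 2 ^ 29 * Zω * Zt ^ 3 * Za * U ^ 3 * l ^ k / l ^ 2 + ZAa * U ^ 3 * l ^ k / l ^ 2 +
      (2 ^ 38 * Zt ^ 2 * Zb * U ^ 3 * l ^ k / l ^ 2 + ZAb * U ^ 3 * l ^ k / l ^ 2) +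
      (2 ^ 33 * Zt * Zc * U ^ 3 * l ^ k / l ^ 2 + ZAc * U ^ 3 * l ^ k / l ^ 2) =
      (2 ^ 29 * Zω * Zt ^ 3 * Za + 2 ^ 38 * Zt ^ 2 * Zb + 2 ^ 33 * Zt * Zc + (ZAa + ZAb + ZAc)) * U ^ 3 * l ^ k / l ^ 2 := by ring
  linarith [t1, e1]

/-- **THE FIT WITH THE TRUE CONSTANT.**  `0 < U`, `16·C·U ≤ 1` ⟹ `C·U³·lᵏ/l² ≤ curveJetBar e_R e_R′ U k (m+1)` for `k ≤ 4`, `l = 4^m`,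
`e_R = fun k => if k = 0 then 0 else 1`, `e_R′ = fun k => if k = 0 then 1 else 0`. -/
theorem lastResponse_rows_fit_curveJetBar_multi {U C : ℝ} (m : ℕ) (hU : 0 < U) (hCU : 16 * C * U ≤ 1) :
    ∀ k ≤ 4, C * U ^ 3 * ((4 : ℝ) ^ m) ^ k / ((4 : ℝ) ^ m) ^ 2 ≤
      curveJetBar (fun k => if k = 0 then 0 else 1) (fun k => if k = 0 then 1 else 0) U k (m + 1) := by
  intro k hk
  have hq0 : (0 : ℝ) < ((4 : ℝ) ^ m) ^ k / (((4 : ℝ) ^ m) ^ 2 * 16) := by positivity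
  have hU2 : 16 * C * U * U ^ 2 ≤ 1 * U ^ 2 := mul_le_mul_of_nonneg_right hCU (by positivity)
  have key : C * U ^ 3 * 16 ≤
      (((fun k : ℕ => if k = 0 then (0 : ℝ) else 1) k + (fun k : ℕ => if k = 0 then (1 : ℝ) else 0) k * |U|) * uPow k U * 4 ^ k) := by
    rcases Nat.eq_zero_or_pos k with rfl | hkpos
    · simp only [uPow_zero, abs_of_pos hU, pow_zero]
      rw [if_pos trivial, if_pos trivial]
      nlinarith [hU2]
    · have hk0 : k ≠ 0 := Nat.pos_iff_ne_zero.mp hkpos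
      simp only [if_neg hk0, uPow, zero_mul, add_zero, one_mul]
      have h4k : (4 : ℝ) ≤ 4 ^ k := by simpa using pow_le_pow_right₀ (by norm_num : (1 : ℝ) ≤ 4) hkpos
      nlinarith [hU2, mul_le_mul_of_nonneg_left h4k (pow_pos hU 2).le, pow_pos hU 2, pow_pos hU 3]
  have eqL : C * U ^ 3 * ((4 : ℝ) ^ m) ^ k / ((4 : ℝ) ^ m) ^ 2 = (C * U ^ 3 * 16) * (((4 : ℝ) ^ m) ^ k / (((4 : ℝ) ^ m) ^ 2 * 16)) := by
    field_simp
  have eqR : curveJetBar (fun k => if k = 0 then 0 else 1) (fun k => if k = 0 then 1 else 0) U k (m + 1) =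
      (((fun k : ℕ => if k = 0 then (0 : ℝ) else 1) k + (fun k : ℕ => if k = 0 then (1 : ℝ) else 0) k * |U|) * uPow k U * 4 ^ k) *
        (((4 : ℝ) ^ m) ^ k / (((4 : ℝ) ^ m) ^ 2 * 16)) := by
    rw [curveJetBar_apply, four_zpow_sub_two_mul, pow_succ, mul_pow, mul_pow]
    field_simp
    ring
  rw [eqL, eqR]
  exact mul_le_mul_of_nonneg_right key hq0.le

/-- **The fit under the NAMED threshold**: `16·C ≤ 2²⁵⁶·klEngPsq⁴·klEngRsq⁸·(klE3Acum²+1)²`, `0 < U ≤ klLastRespU P R` ⟹ the rows fit (`mul_le_one_of_le_klLastRespU`). -/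
theorem lastResponse_rows_fit_multi_of_le_klLastRespU (P : SplitConsts) (R : RenConsts) {U C : ℝ} (m : ℕ) (hU : 0 < U)
    (hCden : 16 * C ≤ (2 : ℝ) ^ 256 * klEngPsq P ^ 4 * klEngRsq R ^ 8 * (klE3Acum R ^ 2 + 1) ^ 2) (hUR : U ≤ klLastRespU P R) :
    ∀ k ≤ 4, C * U ^ 3 * ((4 : ℝ) ^ m) ^ k / ((4 : ℝ) ^ m) ^ 2 ≤
      curveJetBar (fun k => if k = 0 then 0 else 1) (fun k => if k = 0 then 1 else 0) U k (m + 1) :=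
  lastResponse_rows_fit_curveJetBar_multi m hU (mul_le_one_of_le_klLastRespU hCden hU.le hUR)

end Summit.HubbardSuperconductivity.HubbardSuperconductivity.Theorems.EngineV8

end
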